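/-
Copyright: cell pub-balaban-gaps, seat ne8 (estimate NE7c), gen 17. Project licence.
-/
import Summits.QuantumFields.BalabanUV.T4Continuum.Spine.NE7c.LiveFactorSUNTubeCoords
import Summits.QuantumFields.BalabanUV.T4Continuum.Spine.NE7c.LiveFactorCylinderVolume

/-!
# The central tube segment of `U(N)` in CAYLEY COORDINATES is squeezed between solid cylinders over the direction `i·1` of `𝔲(N)` — step B1b of VALUING the
# small-ball constant `C₀(SU(N))` of this seat's file 36 for every `N` (row NE7c, HANDOFF § GEN 16 open point (vi′); [folklore])

Cell `pub-balaban-gaps` (G2), seat ne8, estimate **NE7c**.  Proof-only file under `Spine/NE7c/`: imports this seat's `LiveFactorSUNTubeCoords` (B1a: the direction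
`d = unskew(i·1)`, `τ = imTrace ∕ N`, `P₀ x = x − τ(x)·d`, the near-identity estimate `norm_ichart_exp_sub_le`, the exponential coordinates `exists_expCoords`,
`exists_abs_arg_det_lt`, `norm_specialPart_sub_one_le`), hence transitively `SpecialUnitarySmallBall` (cell pub-lqcd) and `WeylIntegrationSpecialUnitary`, and this seat's
file 41 `LiveFactorCylinderVolume` (B2, Mathlib-only: `volume_cylinder`), BY NAME.  No `def`; 0 `sorry`.

ROUTE B FOR `C₀(SU(N))` (B0 = file 40 `LiveFactorSUNCentralTube`: `Haar_{SU(N)}{‖V − 1‖ ≤ δ} = m · Haar_{U(N)} P(δ, π∕m)` with the CENTRAL TUBE SEGMENT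
`P(δ, t) = {u : ‖specialPart u − 1‖ ≤ δ ∧ arg det u ∈ (−t, t]}`; B2 = file 41 `LiveFactorCylinderVolume`; B3 assembly NOT claimed here).  THIS FILE: in the Cayley
chart `chart : 𝔼 N → U(N)` of `UnitaryCayleyChart` (whose pull-back of Haar is squeezed by `c_N(1 ± o(1))·Lebesgue` on all subsets of small balls, `chartMeasure_le` ∕
`le_chartMeasure_of_subset`), the tube segment `P(δ, t)` is squeezed between SOLID CYLINDERS `Cyl(ρ, J) = {x : ‖P₀ x‖ ≤ ρ ∧ τ x ∈ J}` of `𝔼 N`.  For every `ε > 0`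
there is `δ₀ > 0` such that for `0 < δ`, `0 ≤ t`, `δ + t ≤ δ₀`:
* **`tube_subset_chart_image_cylinder`** (OUTER): `P(δ, t) ⊆ chart '' Cyl(δ + ε(δ + t), [−t∕N − ε(δ+t), t∕N + ε(δ+t)])`;
* **`chart_image_cylinder_subset_tube`** (INNER): `chart '' Cyl(δ − ε(δ + t), (−t∕N + ε(δ+t), t∕N − ε(δ+t)]) ⊆ P(δ, t)`.
MECHANISM ([folklore]): the exponential coordinates `y = a + φ·d` of `u = e^{iφ}·exp(skewOf a)` are an EXACT cylinder description of the tube; the Cayley coordinates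
`x = ichart u` differ from `y` by `‖x − y‖ ≤ c‖y‖` with `c → 0`, and `τ`, `P₀` are `1∕√N`- resp. `1`-Lipschitz, so the cylinders thicken ∕ shrink by `c‖y‖`; in
the inner direction the smallness of `φ` comes from the continuity of `arg ∘ det` at `1`.
* §6 the same cylinders in the form of B2 (`e = d∕√N`, `⟪x, e⟫ = √N·τ x`: `cylinder_eq`), their volume in real form **`volume_cylinder_toReal`**
  (`vol(J')·ρ^{N²−1}·(√π)^{N²−1}∕Γ((N²−1)∕2+1)`, `J'` the `√N`-dilate of `J`; `N ≥ 2`) and `cylinder_subset_closedBall` (for `le_chartMeasure_of_subset`).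

HONEST: metric geometry of two charts of `U(N)` ([folklore]); nothing of the interacting measure, nothing of Bałaban's; `C₀(SU(N))` is NOT valued in this file.
NE7c NOT proved; WORD UNCHANGED (WORK-bound behind node O; INSTANCE 0∕1); spine 0∕9; one finite T⁴ — NOT ℝ⁴, NOT infinite volume, NOT the mass gap, NOT Clay.
-/

set_option autoImplicit false

noncomputable section

open scoped Matrix.Norms.Frobenius Real ComplexConjugate Matrix
open MeasureTheory Set Filter Complex Metric NormedSpace
open Literature.MathematicalPhysics.QuantumFieldTheory (haarProbability)
open Literature.MathematicalPhysics.QuantumFieldTheory.UnitaryCayley (𝔼 𝔾 skewOf unskew skewOf_unskew unskew_skewOf unskew_apply skewOf_apply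
  conjTranspose_skewOf cay icay chart ichart coe_chart chart_ichart ichart_chart norm_chart_sub_one_le norm_ichart_le norm_cay_sub_taylor_le
  frobenius_norm_sq)
open Literature.RepresentationTheory.CompactGroups.WeylIntegration (detPhase specialPart coe_specialPart coe_eq_detPhase_smul norm_det_eq_one)
open Summit.Ventures.LatticeQCDFlow.Theory2.Lattice.SUN (imTrace imTrace_apply suAlg suChart coe_suChart suChart_zero dist_suChart suChart_fill
  suChart_biLipschitz exp_sub_exp_approx imTrace_unskew_I_smul_one)

open Summit.QuantumFields.BalabanUV.T4Continuum.Spine.NE7c.LiveFactorSUNTubeCoords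
open Summit.QuantumFields.BalabanUV.T4Continuum.Spine.NE7c.LiveFactorCylinderVolume (volume_cylinder)
open Literature.MathematicalPhysics.QuantumFieldTheory.UnitaryCayley (finrank_𝔼)

namespace Summit.QuantumFields.BalabanUV.T4Continuum.Spine.NE7c.LiveFactorSUNTubeChart

variable {N : ℕ}

/-! ## §4 OUTER: the tube segment lies in the chart image of a slightly thickened cylinder -/

/-- **OUTER SQUEEZE**: for every `ε > 0` there is `δ₀ > 0` such that for `0 < δ`, `0 ≤ t`, `δ + t ≤ δ₀` every `u` of the central tube segment
`P(δ, t) = {‖specialPart u − 1‖ ≤ δ ∧ arg det u ∈ (−t, t]}` is `chart x` with `‖P₀ x‖ ≤ δ + ε(δ + t)` and `τ x ∈ [−t∕N − ε(δ+t), t∕N + ε(δ+t)]` (`N ≥ 1`). [folklore] -/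
theorem tube_subset_chart_image_cylinder [NeZero N] {ε : ℝ} (hε : 0 < ε) : ∃ δ₀ : ℝ, 0 < δ₀ ∧ ∀ δ t : ℝ, 0 < δ → 0 ≤ t → δ + t ≤ δ₀ →
    {u : 𝔾 N | ‖((specialPart u : Matrix.specialUnitaryGroup (Fin N) ℂ) : Matrix (Fin N) (Fin N) ℂ) - 1‖ ≤ δ ∧
        arg (u : Matrix (Fin N) (Fin N) ℂ).det ∈ Set.Ioc (-t) t}
      ⊆ chart '' {x : 𝔼 N | ‖x - (imTrace N x / N) • unskew ((I : ℂ) • (1 : Matrix (Fin N) (Fin N) ℂ))‖ ≤ δ + ε * (δ + t) ∧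
          imTrace N x / N ∈ Set.Icc (-(t / N) - ε * (δ + t)) (t / N + ε * (δ + t))} := by
  have hN0 : (0 : ℝ) < N := Nat.cast_pos.2 (Nat.pos_of_ne_zero (NeZero.ne N))
  have hN1 : (1 : ℝ) ≤ N := by exact_mod_cast Nat.pos_of_ne_zero (NeZero.ne N)
  have hsN1 : 1 ≤ Real.sqrt N := by rw [← Real.sqrt_one]; exact Real.sqrt_le_sqrt hN1
  have hsNN : Real.sqrt N ≤ N := by
    have h := Real.sqrt_le_sqrt (show (N : ℝ) ≤ N ^ 2 by nlinarith)
    rwa [Real.sqrt_sq hN0.le] at h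
  -- exponential coordinates with `ε₁ = ε/2`, near-identity with `c = ε / (2K)`, `K = 3 + ε`
  obtain ⟨r₁, hr₁, hcoord⟩ := exists_expCoords (N := N) (ε := ε / 2) (by positivity)
  set K : ℝ := 3 + ε with hK
  have hK0 : 0 < K := by positivity
  obtain ⟨r₂, hr₂, hnear⟩ := norm_ichart_exp_sub_le (N := N) (c := ε / (2 * K)) (by positivity)
  refine ⟨min r₁ (r₂ / K), by positivity, fun δ t hδ ht hR => ?_⟩
  set R := δ + t with hRdef
  have hδR : δ ≤ R := by rw [hRdef]; linarith
  have htR : t ≤ R := by rw [hRdef]; linarith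
  rintro u ⟨hW, hφ1, hφ2⟩
  -- exponential coordinates of `u`
  obtain ⟨a, ha, haW, -, hu⟩ := hcoord u δ hδ.le (hδR.trans (hR.trans (min_le_left _ _))) hW
  set φ : ℝ := arg (u : Matrix (Fin N) (Fin N) ℂ).det / N with hφdef
  set y : 𝔼 N := (a : 𝔼 N) + φ • unskew ((I : ℂ) • (1 : Matrix (Fin N) (Fin N) ℂ)) with hydef
  have hφt : |φ| ≤ t / N := by
    rw [hφdef, abs_div, abs_of_pos hN0, div_le_div_iff_of_pos_right hN0, abs_le]; exact ⟨hφ1.le, hφ2⟩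
  have hyn : ‖y‖ ≤ K * R := by
    calc ‖y‖ ≤ ‖(a : 𝔼 N)‖ + ‖φ • unskew ((I : ℂ) • (1 : Matrix (Fin N) (Fin N) ℂ))‖ := norm_add_le _ _
      _ = ‖(a : 𝔼 N)‖ + |φ| * Real.sqrt N := by rw [norm_smul, Real.norm_eq_abs, norm_d]
      _ ≤ (1 + ε / 2) * δ + t / N * N := by gcongr
      _ = (1 + ε / 2) * δ + t := by field_simp
      _ ≤ K * R := by rw [hK]; nlinarith
  have hyr : ‖y‖ ≤ r₂ := hyn.trans (by
    have := hR.trans (min_le_right _ _); rwa [le_div_iff₀ hK0, mul_comm] at this)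
  obtain ⟨-, hlt2, hxy⟩ := hnear y hyr
  -- the point `u` as the exponential of `y`, and its Cayley coordinates `x`
  have huy : u = ⟨exp (skewOf y), exp_skewOf_mem_unitaryGroup y⟩ := Subtype.ext hu.symm
  set x : 𝔼 N := ichart u with hxdef
  have hx : x = ichart ⟨exp (skewOf y), exp_skewOf_mem_unitaryGroup y⟩ := by rw [hxdef, huy]
  rw [← hx] at hxy
  have hcR : ε / (2 * K) * ‖y‖ ≤ ε / 2 * R := by
    calc ε / (2 * K) * ‖y‖ ≤ ε / (2 * K) * (K * R) := by gcongr
      _ = ε / 2 * R := by field_simp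
  have hxy' : ‖x - y‖ ≤ ε / 2 * R := hxy.trans hcR
  refine ⟨x, ⟨?_, ?_⟩, ?_⟩
  · -- projection: `P₀ x = P₀ y + P₀ (x − y)`, `P₀ y = a`, contraction
    have hPy : y - (imTrace N y / N) • unskew ((I : ℂ) • (1 : Matrix (Fin N) (Fin N) ℂ)) = (a : 𝔼 N) := by
      rw [hydef, tau_expCoords]; abel
    have hlin : x - (imTrace N x / N) • unskew ((I : ℂ) • (1 : Matrix (Fin N) (Fin N) ℂ))
        = (y - (imTrace N y / N) • unskew ((I : ℂ) • (1 : Matrix (Fin N) (Fin N) ℂ)))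
          + ((x - y) - (imTrace N (x - y) / N) • unskew ((I : ℂ) • (1 : Matrix (Fin N) (Fin N) ℂ))) := by
      rw [map_sub, sub_div, sub_smul]; abel
    rw [hlin, hPy]
    calc ‖(a : 𝔼 N) + ((x - y) - (imTrace N (x - y) / N) • unskew ((I : ℂ) • (1 : Matrix (Fin N) (Fin N) ℂ)))‖
        ≤ ‖(a : 𝔼 N)‖ + ‖(x - y) - (imTrace N (x - y) / N) • unskew ((I : ℂ) • (1 : Matrix (Fin N) (Fin N) ℂ))‖ := norm_add_le _ _
      _ ≤ (1 + ε / 2) * δ + ‖x - y‖ := add_le_add ha (norm_proj_le _)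
      _ ≤ (1 + ε / 2) * δ + ε / 2 * R := by linarith
      _ ≤ δ + ε * (δ + t) := by rw [← hRdef]; nlinarith
  · -- trace coordinate: `τ x = φ + τ (x − y)`, `|τ (x − y)| ≤ ‖x − y‖`
    have hτ : imTrace N x / N = φ + imTrace N (x - y) / N := by
      have : x = y + (x - y) := by abel
      conv_lhs => rw [this]
      rw [map_add, add_div, hydef, tau_expCoords]
    have hτb : |imTrace N (x - y) / N| ≤ ε / 2 * R := by
      have h := sqrt_mul_abs_tau_le (x - y)
      have : |imTrace N (x - y) / N| ≤ Real.sqrt N * |imTrace N (x - y) / N| :=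
        le_mul_of_one_le_left (abs_nonneg _) hsN1
      linarith
    rw [abs_le] at hτb
    rw [abs_le] at hφt
    rw [hτ, Set.mem_Icc]
    have hR0 : 0 ≤ R := hδ.le.trans hδR
    constructor <;> nlinarith [hφt.1, hφt.2, hτb.1, hτb.2, hε, hR0]
  · rw [hxdef]; exact chart_ichart (by rw [huy]; exact hlt2)

/-! ## §5 INNER: the chart image of a slightly shrunken cylinder lies in the tube segment -/

/-- **INNER SQUEEZE**: for every `ε > 0` there is `δ₀ > 0` such that for `0 < δ`, `0 ≤ t`, `δ + t ≤ δ₀` the chart image of the cylinder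
`{‖P₀ x‖ ≤ δ − ε(δ + t) ∧ τ x ∈ (−t∕N + ε(δ+t), t∕N − ε(δ+t)]}` lies in the tube segment `P(δ, t)` (`N ≥ 1`). [folklore] -/
theorem chart_image_cylinder_subset_tube [NeZero N] {ε : ℝ} (hε : 0 < ε) : ∃ δ₀ : ℝ, 0 < δ₀ ∧ ∀ δ t : ℝ, 0 < δ → 0 ≤ t → δ + t ≤ δ₀ →
    chart '' {x : 𝔼 N | ‖x - (imTrace N x / N) • unskew ((I : ℂ) • (1 : Matrix (Fin N) (Fin N) ℂ))‖ ≤ δ - ε * (δ + t) ∧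
          imTrace N x / N ∈ Set.Ioc (-(t / N) + ε * (δ + t)) (t / N - ε * (δ + t))}
      ⊆ {u : 𝔾 N | ‖((specialPart u : Matrix.specialUnitaryGroup (Fin N) ℂ) : Matrix (Fin N) (Fin N) ℂ) - 1‖ ≤ δ ∧
          arg (u : Matrix (Fin N) (Fin N) ℂ).det ∈ Set.Ioc (-t) t} := by
  have hN0 : (0 : ℝ) < N := Nat.cast_pos.2 (Nat.pos_of_ne_zero (NeZero.ne N))
  have hN1 : (1 : ℝ) ≤ N := by exact_mod_cast Nat.pos_of_ne_zero (NeZero.ne N)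
  have hsN1 : 1 ≤ Real.sqrt N := by rw [← Real.sqrt_one]; exact Real.sqrt_le_sqrt hN1
  have hsNN : Real.sqrt N ≤ N := by
    have h := Real.sqrt_le_sqrt (show (N : ℝ) ≤ N ^ 2 by nlinarith)
    rwa [Real.sqrt_sq hN0.le] at h
  -- constants: exponential coordinates with `ε' = ε/2`; near-identity with `c = min (ε/4) (1/2)`; scale `M`
  obtain ⟨r₁, hr₁, hcoord⟩ := exists_expCoords (N := N) (ε := ε / 2) (by positivity)
  set c : ℝ := min (ε / 4) (1 / 2) with hcdef
  have hc0 : 0 < c := by positivity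
  have hcε : c ≤ ε / 4 := min_le_left _ _
  have hc2 : c ≤ 1 / 2 := min_le_right _ _
  obtain ⟨r₂, hr₂, hnear⟩ := norm_ichart_exp_sub_le (N := N) hc0
  set M : ℝ := min r₁ r₂ / (4 * (2 + ε)) with hMdef
  have hM0 : 0 < M := by positivity
  have hMr : (2 + ε) * M = min r₁ r₂ / 4 := by rw [hMdef]; field_simp
  have hmin1 : min r₁ r₂ ≤ r₁ := min_le_left _ _
  have hmin2 : min r₁ r₂ ≤ r₂ := min_le_right _ _
  have hM8 : M ≤ min r₁ r₂ / 8 := by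
    rw [hMdef, div_le_div_iff_of_pos_left (by positivity) (by positivity) (by norm_num)]; nlinarith
  -- continuity of `arg det` at `1`
  obtain ⟨s, hs, harg⟩ := exists_abs_arg_det_lt (N := N) hM0
  refine ⟨min (s / 2) M, by positivity, fun δ t hδ ht hR => ?_⟩
  set R := δ + t with hRdef
  have hδR : δ ≤ R := by rw [hRdef]; linarith
  have hR0 : 0 ≤ R := hδ.le.trans hδR
  have hRs : R < s := lt_of_le_of_lt (hR.trans (min_le_left _ _)) (by linarith)
  have hRM : R ≤ M := hR.trans (min_le_right _ _)
  rintro u ⟨x, ⟨hPx, hτ1, hτ2⟩, rfl⟩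
  -- size of `x` and of `u = chart x`
  have hxn : ‖x‖ ≤ R := by
    have hdecomp : x = (x - (imTrace N x / N) • unskew ((I : ℂ) • (1 : Matrix (Fin N) (Fin N) ℂ)))
        + (imTrace N x / N) • unskew ((I : ℂ) • (1 : Matrix (Fin N) (Fin N) ℂ)) := by abel
    have hτabs : |imTrace N x / N| ≤ t / N := by
      rw [abs_le]; constructor <;> nlinarith [mul_nonneg hε.le hR0]
    calc ‖x‖ = ‖(x - (imTrace N x / N) • unskew ((I : ℂ) • (1 : Matrix (Fin N) (Fin N) ℂ)))
        + (imTrace N x / N) • unskew ((I : ℂ) • (1 : Matrix (Fin N) (Fin N) ℂ))‖ := by rw [← hdecomp]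
      _ ≤ ‖x - (imTrace N x / N) • unskew ((I : ℂ) • (1 : Matrix (Fin N) (Fin N) ℂ))‖
          + ‖(imTrace N x / N) • unskew ((I : ℂ) • (1 : Matrix (Fin N) (Fin N) ℂ))‖ := norm_add_le _ _
      _ ≤ (δ - ε * R) + t / N * N := by
          rw [norm_smul, Real.norm_eq_abs, norm_d]
          gcongr
      _ ≤ R := by
          have : t / N * N = t := by field_simp
          rw [this, hRdef]; nlinarith [mul_nonneg hε.le hR0]
  have hu1 : ‖((chart x : 𝔾 N) : Matrix (Fin N) (Fin N) ℂ) - 1‖ ≤ R := (norm_chart_sub_one_le x).trans hxn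
  -- the phase is small by continuity, hence the special part is near `1`
  have hargs : |arg ((chart x : 𝔾 N) : Matrix (Fin N) (Fin N) ℂ).det| < M := harg (chart x) (lt_of_le_of_lt hu1 hRs)
  set φ : ℝ := arg ((chart x : 𝔾 N) : Matrix (Fin N) (Fin N) ℂ).det / N with hφdef
  have hφM : |φ| * Real.sqrt N ≤ M := by
    rw [hφdef, abs_div, abs_of_pos hN0]
    calc |arg ((chart x : 𝔾 N) : Matrix (Fin N) (Fin N) ℂ).det| / N * Real.sqrt N
        ≤ |arg ((chart x : 𝔾 N) : Matrix (Fin N) (Fin N) ℂ).det| / N * N := by gcongr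
      _ = |arg ((chart x : 𝔾 N) : Matrix (Fin N) (Fin N) ℂ).det| := by field_simp
      _ ≤ M := hargs.le
  have hWle : ‖((specialPart (chart x) : Matrix.specialUnitaryGroup (Fin N) ℂ) : Matrix (Fin N) (Fin N) ℂ) - 1‖ ≤ 2 * M := by
    refine (norm_specialPart_sub_one_le (chart x)).trans ?_
    rw [← hφdef]; linarith
  have h2M : 2 * M ≤ r₁ := by nlinarith
  obtain ⟨a, ha, haW, hWa, hu⟩ := hcoord (chart x) (2 * M) (by positivity) h2M hWle
  rw [← hφdef] at hu
  set y : 𝔼 N := (a : 𝔼 N) + φ • unskew ((I : ℂ) • (1 : Matrix (Fin N) (Fin N) ℂ)) with hydef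
  -- near-identity at `y`
  have hyn : ‖y‖ ≤ r₂ := by
    calc ‖y‖ ≤ ‖(a : 𝔼 N)‖ + ‖φ • unskew ((I : ℂ) • (1 : Matrix (Fin N) (Fin N) ℂ))‖ := norm_add_le _ _
      _ = ‖(a : 𝔼 N)‖ + |φ| * Real.sqrt N := by rw [norm_smul, Real.norm_eq_abs, norm_d]
      _ ≤ (1 + ε / 2) * (2 * M) + M := add_le_add ha hφM
      _ = (2 + ε) * M + M := by ring
      _ ≤ r₂ := by rw [hMr]; nlinarith
  obtain ⟨-, -, hxy⟩ := hnear y hyn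
  have huy : chart x = ⟨exp (skewOf y), exp_skewOf_mem_unitaryGroup y⟩ := Subtype.ext hu.symm
  rw [← huy, ichart_chart] at hxy
  -- `‖y‖ ≤ 2R`, `‖x − y‖ ≤ 2cR`
  have hy2 : ‖y‖ ≤ 2 * R := by
    have h1 : ‖y‖ ≤ ‖x‖ + ‖x - y‖ := by
      calc ‖y‖ = ‖x - (x - y)‖ := by rw [sub_sub_cancel]
        _ ≤ ‖x‖ + ‖x - y‖ := norm_sub_le _ _
    have h2 : c * ‖y‖ ≤ 1 / 2 * ‖y‖ := mul_le_mul_of_nonneg_right hc2 (norm_nonneg y)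
    linarith only [h1, h2, hxn, hxy]
  have hxy' : ‖x - y‖ ≤ ε / 2 * R := by
    have h2 : c * ‖y‖ ≤ ε / 4 * (2 * R) := mul_le_mul hcε hy2 (norm_nonneg _) (by linarith only [hε])
    linarith only [hxy, h2]
  -- trace coordinate of `y` is `φ`; compare with that of `x`
  have hτy : imTrace N y / N = φ := by rw [hydef, tau_expCoords]
  have hτdiff : |imTrace N x / N - φ| ≤ ε / 2 * R := by
    have h := sqrt_mul_abs_tau_le (x - y)
    rw [map_sub, sub_div, hτy] at h
    have : |imTrace N x / N - φ| ≤ Real.sqrt N * |imTrace N x / N - φ| := le_mul_of_one_le_left (abs_nonneg _) hsN1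
    linarith only [h, this, hxy']
  rw [abs_le] at hτdiff
  refine ⟨?_, ?_, ?_⟩
  · -- `‖specialPart u − 1‖ ≤ (1 + ε/2)‖a‖`, `‖a‖ = ‖P₀ y‖ ≤ ‖P₀ x‖ + ‖x − y‖`
    have hPy : y - (imTrace N y / N) • unskew ((I : ℂ) • (1 : Matrix (Fin N) (Fin N) ℂ)) = (a : 𝔼 N) := by
      rw [hτy, hydef]; abel
    have hlin : (a : 𝔼 N) = (x - (imTrace N x / N) • unskew ((I : ℂ) • (1 : Matrix (Fin N) (Fin N) ℂ)))
        - ((x - y) - (imTrace N (x - y) / N) • unskew ((I : ℂ) • (1 : Matrix (Fin N) (Fin N) ℂ))) := by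
      rw [← hPy, map_sub, sub_div, sub_smul]; abel
    have han : ‖(a : 𝔼 N)‖ ≤ (δ - ε * R) + ε / 2 * R := by
      rw [hlin]
      exact (norm_sub_le _ _).trans (add_le_add hPx ((norm_proj_le _).trans hxy'))
    have hbound : (1 + ε / 2) * ((δ - ε * R) + ε / 2 * R) ≤ δ := by
      have hid : δ - (1 + ε / 2) * ((δ - ε * R) + ε / 2 * R) = ε / 2 * (R - δ) + ε ^ 2 / 4 * R := by ring
      have hnn : 0 ≤ ε / 2 * (R - δ) + ε ^ 2 / 4 * R :=
        add_nonneg (mul_nonneg (by linarith only [hε]) (sub_nonneg.2 hδR)) (by positivity)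
      linarith only [hid, hnn]
    calc ‖((specialPart (chart x) : Matrix.specialUnitaryGroup (Fin N) ℂ) : Matrix (Fin N) (Fin N) ℂ) - 1‖
        ≤ (1 + ε / 2) * ‖(a : 𝔼 N)‖ := hWa
      _ ≤ (1 + ε / 2) * ((δ - ε * R) + ε / 2 * R) := mul_le_mul_of_nonneg_left han (by linarith only [hε])
      _ ≤ δ := hbound
  · -- `arg det u = Nφ > −t`
    have hNφ : arg ((chart x : 𝔾 N) : Matrix (Fin N) (Fin N) ℂ).det = N * φ := by rw [hφdef]; field_simp
    rw [hNφ]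
    have h1 : -(t / N) + ε / 2 * R < φ := by linarith only [hτ1, hτdiff.1, hτdiff.2]
    have h2 : (-(t / N) + ε / 2 * R) * N = -t + ε / 2 * R * N := by field_simp
    have h3 : (-(t / N) + ε / 2 * R) * N < φ * N := mul_lt_mul_of_pos_right h1 hN0
    have h4 : 0 ≤ ε / 2 * R * N := by positivity
    linarith only [h2, h3, h4]
  · have hNφ : arg ((chart x : 𝔾 N) : Matrix (Fin N) (Fin N) ℂ).det = N * φ := by rw [hφdef]; field_simp
    rw [hNφ]
    have h1 : φ ≤ t / N - ε / 2 * R := by linarith only [hτ2, hτdiff.1, hτdiff.2]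
    have h2 : (t / N - ε / 2 * R) * N = t - ε / 2 * R * N := by field_simp
    have h3 : φ * N ≤ (t / N - ε / 2 * R) * N := mul_le_mul_of_nonneg_right h1 hN0.le
    have h4 : 0 ≤ ε / 2 * R * N := by positivity
    linarith only [h2, h3, h4]


/-! ## §6 The cylinders in the form of file 41 (B2 `LiveFactorCylinderVolume`): `e = d∕√N`, `⟪x, e⟫ = √N·τ(x)`, volume `√N·|J|·ω·ρ^{N²−1}` -/

/-- `⟪x, d∕√N⟫ = √N · (imTrace x ∕ N)` (`N ≥ 1`). [folklore] -/
theorem inner_e_eq [NeZero N] (x : 𝔼 N) :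
    inner ℝ x ((Real.sqrt N)⁻¹ • unskew ((I : ℂ) • (1 : Matrix (Fin N) (Fin N) ℂ))) = Real.sqrt N * (imTrace N x / N) := by
  have hN : (0 : ℝ) < N := Nat.cast_pos.2 (Nat.pos_of_ne_zero (NeZero.ne N))
  have hs : Real.sqrt N ≠ 0 := (Real.sqrt_pos.2 hN).ne'
  rw [real_inner_smul_right, inner_d_eq_imTrace]
  symm
  rw [mul_div_assoc', mul_comm (Real.sqrt N), mul_div_assoc, Real.sqrt_div_self, mul_comm]

/-- `⟪x, e⟫·e = τ(x)·d` for `e = d∕√N`. [folklore] -/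
theorem inner_e_smul_e_eq [NeZero N] (x : 𝔼 N) :
    inner ℝ x ((Real.sqrt N)⁻¹ • unskew ((I : ℂ) • (1 : Matrix (Fin N) (Fin N) ℂ))) • ((Real.sqrt N)⁻¹ • unskew ((I : ℂ) • (1 : Matrix (Fin N) (Fin N) ℂ)))
      = (imTrace N x / N) • unskew ((I : ℂ) • (1 : Matrix (Fin N) (Fin N) ℂ)) := by
  have hN : (0 : ℝ) < N := Nat.cast_pos.2 (Nat.pos_of_ne_zero (NeZero.ne N))
  have hs : Real.sqrt N ≠ 0 := (Real.sqrt_pos.2 hN).ne'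
  rw [inner_e_eq, smul_smul]
  congr 1
  field_simp

/-- `‖e‖ = 1`. [folklore] -/
theorem norm_e [NeZero N] : ‖(Real.sqrt N)⁻¹ • unskew ((I : ℂ) • (1 : Matrix (Fin N) (Fin N) ℂ))‖ = 1 := by
  have hN : (0 : ℝ) < N := Nat.cast_pos.2 (Nat.pos_of_ne_zero (NeZero.ne N))
  rw [norm_smul, norm_inv, Real.norm_eq_abs, abs_of_pos (Real.sqrt_pos.2 hN), norm_d, inv_mul_cancel₀ (Real.sqrt_pos.2 hN).ne']

/-- **B1's CYLINDER IS B2's CYLINDER**: for `J ⊆ ℝ` and its `√N`-dilate `J'` (`s ∈ J ↔ √N·s ∈ J'`),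
`{‖x − τ(x)·d‖ ≤ ρ ∧ τ x ∈ J} = {‖x − ⟪x,e⟫e‖ ≤ ρ ∧ ⟪x,e⟫ ∈ J'}`. [folklore] -/
theorem cylinder_eq [NeZero N] (ρ : ℝ) {J J' : Set ℝ} (hJ : ∀ s : ℝ, s ∈ J ↔ Real.sqrt N * s ∈ J') :
    {x : 𝔼 N | ‖x - (imTrace N x / N) • unskew ((I : ℂ) • (1 : Matrix (Fin N) (Fin N) ℂ))‖ ≤ ρ ∧ imTrace N x / N ∈ J}
      = {x : 𝔼 N | ‖x - inner ℝ x ((Real.sqrt N)⁻¹ • unskew ((I : ℂ) • (1 : Matrix (Fin N) (Fin N) ℂ))) •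
            ((Real.sqrt N)⁻¹ • unskew ((I : ℂ) • (1 : Matrix (Fin N) (Fin N) ℂ)))‖ ≤ ρ ∧
          inner ℝ x ((Real.sqrt N)⁻¹ • unskew ((I : ℂ) • (1 : Matrix (Fin N) (Fin N) ℂ))) ∈ J'} := by
  ext x
  simp only [Set.mem_setOf_eq]
  rw [inner_e_smul_e_eq, inner_e_eq, hJ]

/-- the `√N`-dilates of `Icc` and `Ioc`. [folklore] -/
theorem mem_Icc_iff_sqrt_mul [NeZero N] (a b s : ℝ) : s ∈ Icc a b ↔ Real.sqrt N * s ∈ Icc (Real.sqrt N * a) (Real.sqrt N * b) := by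
  have hs : 0 < Real.sqrt N := Real.sqrt_pos.2 (Nat.cast_pos.2 (Nat.pos_of_ne_zero (NeZero.ne N)))
  simp only [Set.mem_Icc, mul_le_mul_iff_right₀ hs]

/-- [folklore] -/
theorem mem_Ioc_iff_sqrt_mul [NeZero N] (a b s : ℝ) : s ∈ Ioc a b ↔ Real.sqrt N * s ∈ Ioc (Real.sqrt N * a) (Real.sqrt N * b) := by
  have hs : 0 < Real.sqrt N := Real.sqrt_pos.2 (Nat.cast_pos.2 (Nat.pos_of_ne_zero (NeZero.ne N)))
  simp only [Set.mem_Ioc, mul_le_mul_iff_right₀ hs, mul_lt_mul_iff_right₀ hs]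

/-- **THE VOLUME OF B1's CYLINDER** (`N ≥ 2`, `ρ ≥ 0`, `J'` measurable): `vol{‖P₀x‖ ≤ ρ ∧ τ x ∈ J} = vol(J')·ρ^{N²−1}·(√π)^{N²−1}∕Γ((N²−1)∕2+1)` (real form). [folklore] -/
theorem volume_cylinder_toReal (hN : 2 ≤ N) {ρ : ℝ} (hρ : 0 ≤ ρ) {J J' : Set ℝ} (hJ : ∀ s : ℝ, s ∈ J ↔ Real.sqrt N * s ∈ J')
    (hJ' : MeasurableSet J') :
    (volume {x : 𝔼 N | ‖x - (imTrace N x / N) • unskew ((I : ℂ) • (1 : Matrix (Fin N) (Fin N) ℂ))‖ ≤ ρ ∧ imTrace N x / N ∈ J}).toReal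
      = (volume J').toReal * (ρ ^ (N * N - 1) * (Real.sqrt π ^ (N * N - 1) / Real.Gamma ((N * N - 1 : ℕ) / 2 + 1))) := by
  haveI : NeZero N := ⟨by omega⟩
  have hn : Module.finrank ℝ (𝔼 N) = (N * N - 1) + 1 := by
    rw [finrank_𝔼]; have : 1 ≤ N * N := Nat.one_le_iff_ne_zero.2 (Nat.mul_ne_zero (NeZero.ne N) (NeZero.ne N)); omega
  haveI : Nonempty (Fin (N * N - 1)) := Fin.pos_iff_nonempty.1 (by
    have : 4 ≤ N * N := Nat.mul_le_mul hN hN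
    omega)
  rw [cylinder_eq ρ hJ, volume_cylinder hn norm_e ρ hJ', EuclideanSpace.volume_closedBall, Fintype.card_fin, ENNReal.toReal_mul, ENNReal.toReal_mul,
    ← ENNReal.ofReal_pow hρ, ENNReal.toReal_ofReal (pow_nonneg hρ _), ENNReal.toReal_ofReal (by positivity)]

/-- B1's cylinder lies in the ball of radius `ρ + √N·T` when `|τ| ≤ T` on `J` (for the lower density constant). [folklore] -/
theorem cylinder_subset_closedBall [NeZero N] {ρ T : ℝ} {J : Set ℝ} (hJ : ∀ s ∈ J, |s| ≤ T) :
    {x : 𝔼 N | ‖x - (imTrace N x / N) • unskew ((I : ℂ) • (1 : Matrix (Fin N) (Fin N) ℂ))‖ ≤ ρ ∧ imTrace N x / N ∈ J}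
      ⊆ closedBall (0 : 𝔼 N) (ρ + Real.sqrt N * T) := by
  rintro x ⟨hPx, hτ⟩
  rw [mem_closedBall, dist_zero_right]
  have hdec : x = (x - (imTrace N x / N) • unskew ((I : ℂ) • (1 : Matrix (Fin N) (Fin N) ℂ)))
      + (imTrace N x / N) • unskew ((I : ℂ) • (1 : Matrix (Fin N) (Fin N) ℂ)) := by abel
  calc ‖x‖ = ‖(x - (imTrace N x / N) • unskew ((I : ℂ) • (1 : Matrix (Fin N) (Fin N) ℂ)))
      + (imTrace N x / N) • unskew ((I : ℂ) • (1 : Matrix (Fin N) (Fin N) ℂ))‖ := by rw [← hdec]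
    _ ≤ ρ + ‖(imTrace N x / N) • unskew ((I : ℂ) • (1 : Matrix (Fin N) (Fin N) ℂ))‖ := (norm_add_le _ _).trans (add_le_add hPx le_rfl)
    _ = ρ + |imTrace N x / N| * Real.sqrt N := by rw [norm_smul, Real.norm_eq_abs, norm_d]
    _ ≤ ρ + Real.sqrt N * T := by nlinarith [hJ _ hτ, Real.sqrt_nonneg (N : ℝ), abs_nonneg (imTrace N x / N)]

end Summit.QuantumFields.BalabanUV.T4Continuum.Spine.NE7c.LiveFactorSUNTubeChart
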